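import Summits.QuantumFields.YangMills.Theorems.UnitScaleTiltProp8FlatPullbackDictionary
import HarnessLib

/-!
# Route `UnitScaleTilt`, crux K1 child «MinimiserStabilityRegPr» (stmt-QuantumFields-19200), registered stub V2′ `stub_halvingStep`
# (skeleton v7 cc37a17877262141) — **[Balaban1985Variational] (159) ⇒ (165) ROW BY ROW ON THE TORUS**: the three torus letters of the
# halving socket (`Prop8PullbackDict.localChart_top_of_torus`: `|A|`, `|∇^ηA|`, flat `|∂^{η*}∂^ηA♯|`) are SUBADDITIVE along the decomposition
# «A = A₁ + HB − HD(A₁ + HB)» (159), so the (165)/(167) size of `A` is the sum of the sizes of its three pieces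

Cell `ym3-torus` (HUMAN RULING D-0037, YM ladder rung R3 — continuum SU(2) YM₃ on the torus is a RUNG, not the Clay problem), width seat
`ym-ust-19200-w3` gen 0.  `--supports stmt-QuantumFields-19200 --as helper`; def-free, 0 sorry, standard axioms.  Bookkeeping only: the three
pieces' bounds ((164) for `HB` = `FlatHBBound164.rows164_quarter`; (165)'s `B₀C₄(…)²` for `A₁` = F4 `FlatSmallSolution158CubeSeq.letter_solution158_dom_le`
+ P3b; `B₀4C₂(…)²` for `HD(A₁ + HB)` = P2 `HSupLetterG`/`HDecayLetterD` on P3a's chart remainder) are NOT proved here.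

THE PRINT (p. 303–304): *«We have constructed the configuration U₁ = e^{iηA}, and A is given by A = A₁ + HB − HD(A₁ + HB), (159) where A₁
satisfies Eq. (158). … This bound [(164)], the equality (159) and Eq. (158) imply |A|, |∇^ηA|, |∂^{η*}∂^ηA|, |Δ^ηA| ≦ ¼M_Δmax{B₃ε₁, ½ε₀} +
B₀C₄(36dL²B₁Mε₀)² + B₀4C₂(36dL²B₁Mε₀)² (165)»*.

WHAT THIS FILE PROVES (torus one-forms `A, A₁, 𝔄, R : PBond P 0 → M_N(ℂ)`, `η : ℝ`, `y := transl 0 z`):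
* §1 `pull_add`/`pull_sub` (pullback is additive); `plaqCovDeriv_flat_pull_add/_sub` (the flat curl of §2 of the dictionary is additive);
  `pdiv_sub` (the flat/any-background divergence of a difference; companion of lit-balaban's `B8Eq143PlaqExpansion.pdiv_add`);
  `d2_flat_pull_add/_sub` — **the second-order letter `∂^{η*}∂^ηA♯` of the socket is additive/subtractive in `A`**.
* §2 `norm_apply_le_of_decomp`, `norm_grad_le_of_decomp`, `norm_d2_le_of_decomp` — for `A = A₁ + 𝔄 − R`, each of the three torus letters of
  `A` at a point is `≤` the sum of the same letter of `A₁`, `𝔄`, `R` (triangle inequality; (159) ⇒ (165) line 1, row by row).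
* §3 `torusBounds_of_decomp` — the three hypotheses `h1`/`h2`/`h3` of `Prop8PullbackDict.localChart_top_of_torus` at threshold `α₂` from per-piece
  bounds `e₁, e₂, e₃` on the same layers with `e₁ + e₂ + e₃ < α₂` (print: `e₁ + e₂ + e₃ = ¼max{B₃ε₁, ½ε₀} + Kε₀²` ≤ (167) after (166); the strict
  margin is the consumer's `α₂`).

HONEST SCOPE: no estimate of Bałaban's is proved; pure linearity and triangle inequalities over lit-balaban's letters at the flat background.
No definition, no sorry, standard axioms.  NOT a claim about the crux, the rung, or the mass gap.

References: T. Bałaban, CMP **102** (1985) 277–309 [Balaban1985Variational] (159) p.303, (165)–(167) p.304; CMP **99** (1985) 75–102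
[Balaban1985RegularSpaces] (1.1)–(1.2) p.76, (1.140) p.100.
-/

set_option autoImplicit false

noncomputable section

open scoped Matrix.Norms.L2Operator BigOperators

namespace Summit.QuantumFields.YangMills.Theorems.Prop8PullbackLin

open Literature.MathematicalPhysics.QuantumFieldTheory.Balaban1983to89
open B7Prop1Explicit (e)
open B8Ineq132 (covDeriv BondTouches)
open B8Eq140Level (SideTouches)
open B8Eq143PlaqExpansion (pdiv pdiv_add)
open B8Eq146AExpansion (plaqCovDeriv)
open B8Thm2SetupTorus (pullDom)
open B10Eq27TorusAxialLog (pull transl pull_apply)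
open Summit.QuantumFields.YangMills.Theorems.Prop8PullbackDict (plaqCovDeriv_flat_pull_apply pdiv_flat_apply)

variable {P : Params} {N : ℕ}

/-! ## §1 Linearity of the pullback, the flat curl and the flat divergence -/

/-- The pullback of torus one-forms is additive. [cite: Balaban1985RegularSpaces, (1.3) p.77] -/
theorem pull_add (A B : (PBond P 0 → Matrix (Fin N) (Fin N) ℂ)) : pull (A + B) 0 = pull A 0 + pull B 0 := by
  funext z μ; rfl

/-- The pullback of torus one-forms respects differences. [cite: Balaban1985RegularSpaces, (1.3) p.77] -/
theorem pull_sub (A B : (PBond P 0 → Matrix (Fin N) (Fin N) ℂ)) : pull (A - B) 0 = pull A 0 - pull B 0 := by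
  funext z μ; rfl

/-- The flat curl `∂^η` of the pullback is additive. [cite: Balaban1985RegularSpaces, (1.1)-(1.2) p.76] -/
theorem plaqCovDeriv_flat_pull_add (η : ℝ) (A B : (PBond P 0 → Matrix (Fin N) (Fin N) ℂ)) :
    plaqCovDeriv η (1 : B7Prop1Explicit.Site P.d → Fin P.d → (Matrix (Fin N) (Fin N) ℂ)ˣ) (pull (A + B) 0) =
      plaqCovDeriv η (1 : B7Prop1Explicit.Site P.d → Fin P.d → (Matrix (Fin N) (Fin N) ℂ)ˣ) (pull A 0) +
        plaqCovDeriv η (1 : B7Prop1Explicit.Site P.d → Fin P.d → (Matrix (Fin N) (Fin N) ℂ)ˣ) (pull B 0) := by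
  funext μ ν z
  simp only [Pi.add_apply, plaqCovDeriv_flat_pull_apply, smul_sub, smul_add]
  abel

/-- The flat curl `∂^η` of the pullback respects differences. [cite: Balaban1985RegularSpaces, (1.1)-(1.2) p.76] -/
theorem plaqCovDeriv_flat_pull_sub (η : ℝ) (A B : (PBond P 0 → Matrix (Fin N) (Fin N) ℂ)) :
    plaqCovDeriv η (1 : B7Prop1Explicit.Site P.d → Fin P.d → (Matrix (Fin N) (Fin N) ℂ)ˣ) (pull (A - B) 0) =
      plaqCovDeriv η (1 : B7Prop1Explicit.Site P.d → Fin P.d → (Matrix (Fin N) (Fin N) ℂ)ˣ) (pull A 0) -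
        plaqCovDeriv η (1 : B7Prop1Explicit.Site P.d → Fin P.d → (Matrix (Fin N) (Fin N) ℂ)ˣ) (pull B 0) := by
  funext μ ν z
  simp only [Pi.sub_apply, plaqCovDeriv_flat_pull_apply, smul_sub]
  abel

section AnyBackground

variable {d : ℕ} {𝔸 : Type*} [NormedRing 𝔸] [NormedAlgebra ℂ 𝔸]

/-- The covariant divergence `∂^{η*}_V` of a difference (companion of `B8Eq143PlaqExpansion.pdiv_add`). [cite: Balaban1985RegularSpaces, (1.2) p.76] -/
theorem pdiv_sub (η : ℝ) (V : B7Prop1Explicit.Site d → Fin d → 𝔸ˣ) (F G : Fin d → Fin d → B7Prop1Explicit.Site d → 𝔸) (μ : Fin d)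
    (x : B7Prop1Explicit.Site d) : pdiv η V (F - G) μ x = pdiv η V F μ x - pdiv η V G μ x := by
  have h := pdiv_add η V (F - G) G μ x
  rw [sub_add_cancel] at h
  rw [h, add_sub_cancel_right]

end AnyBackground

/-- **THE SECOND-ORDER LETTER `∂^{η*}∂^ηA♯` IS ADDITIVE IN `A`** (flat background). [cite: Balaban1985RegularSpaces, (1.1)-(1.2) p.76, (1.140) p.100] -/
theorem d2_flat_pull_add (η : ℝ) (A B : (PBond P 0 → Matrix (Fin N) (Fin N) ℂ)) (μ : Fin P.d) (z : B7Prop1Explicit.Site P.d) :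
    pdiv η (1 : B7Prop1Explicit.Site P.d → Fin P.d → (Matrix (Fin N) (Fin N) ℂ)ˣ)
        (plaqCovDeriv η (1 : B7Prop1Explicit.Site P.d → Fin P.d → (Matrix (Fin N) (Fin N) ℂ)ˣ) (pull (A + B) 0)) μ z =
      pdiv η (1 : B7Prop1Explicit.Site P.d → Fin P.d → (Matrix (Fin N) (Fin N) ℂ)ˣ)
          (plaqCovDeriv η (1 : B7Prop1Explicit.Site P.d → Fin P.d → (Matrix (Fin N) (Fin N) ℂ)ˣ) (pull A 0)) μ z +
        pdiv η (1 : B7Prop1Explicit.Site P.d → Fin P.d → (Matrix (Fin N) (Fin N) ℂ)ˣ)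
          (plaqCovDeriv η (1 : B7Prop1Explicit.Site P.d → Fin P.d → (Matrix (Fin N) (Fin N) ℂ)ˣ) (pull B 0)) μ z := by
  rw [plaqCovDeriv_flat_pull_add, pdiv_add]

/-- **THE SECOND-ORDER LETTER `∂^{η*}∂^ηA♯` RESPECTS DIFFERENCES** (flat background). [cite: Balaban1985RegularSpaces, (1.1)-(1.2) p.76, (1.140) p.100] -/
theorem d2_flat_pull_sub (η : ℝ) (A B : (PBond P 0 → Matrix (Fin N) (Fin N) ℂ)) (μ : Fin P.d) (z : B7Prop1Explicit.Site P.d) :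
    pdiv η (1 : B7Prop1Explicit.Site P.d → Fin P.d → (Matrix (Fin N) (Fin N) ℂ)ˣ)
        (plaqCovDeriv η (1 : B7Prop1Explicit.Site P.d → Fin P.d → (Matrix (Fin N) (Fin N) ℂ)ˣ) (pull (A - B) 0)) μ z =
      pdiv η (1 : B7Prop1Explicit.Site P.d → Fin P.d → (Matrix (Fin N) (Fin N) ℂ)ˣ)
          (plaqCovDeriv η (1 : B7Prop1Explicit.Site P.d → Fin P.d → (Matrix (Fin N) (Fin N) ℂ)ˣ) (pull A 0)) μ z -
        pdiv η (1 : B7Prop1Explicit.Site P.d → Fin P.d → (Matrix (Fin N) (Fin N) ℂ)ˣ)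
          (plaqCovDeriv η (1 : B7Prop1Explicit.Site P.d → Fin P.d → (Matrix (Fin N) (Fin N) ℂ)ˣ) (pull B 0)) μ z := by
  rw [plaqCovDeriv_flat_pull_sub, pdiv_sub]

/-! ## §2 (159) ⇒ (165) line 1, row by row: the three letters of `A = A₁ + 𝔄 − R` -/

section Decomp

variable {A A₁ 𝔄 R : (PBond P 0 → Matrix (Fin N) (Fin N) ℂ)}

/-- **ROW `|A|`** of (165): `‖A(b)‖ ≤ ‖A₁(b)‖ + ‖𝔄(b)‖ + ‖R(b)‖` for `A = A₁ + 𝔄 − R`. [cite: Balaban1985Variational, (159) p.303, (165) p.304] -/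
theorem norm_apply_le_of_decomp (hA : A = A₁ + 𝔄 - R) (b : PBond P 0) : ‖A b‖ ≤ ‖A₁ b‖ + ‖𝔄 b‖ + ‖R b‖ := by
  rw [hA, Pi.sub_apply, Pi.add_apply]
  exact (norm_sub_le _ _).trans (add_le_add (norm_add_le _ _) le_rfl)

/-- **ROW `|∇^ηA|`** of (165): the scaled forward difference of `A = A₁ + 𝔄 − R` along `b ↦ b′` is bounded by the sum of the three.
[cite: Balaban1985Variational, (159) p.303, (165) p.304] -/
theorem norm_grad_le_of_decomp (hA : A = A₁ + 𝔄 - R) (c : ℝ) (b b' : PBond P 0) :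
    ‖c • (A b' - A b)‖ ≤ ‖c • (A₁ b' - A₁ b)‖ + ‖c • (𝔄 b' - 𝔄 b)‖ + ‖c • (R b' - R b)‖ := by
  have h : c • (A b' - A b) = c • (A₁ b' - A₁ b) + c • (𝔄 b' - 𝔄 b) - c • (R b' - R b) := by
    rw [hA]; simp only [Pi.sub_apply, Pi.add_apply, smul_sub, smul_add]; abel
  rw [h]
  exact (norm_sub_le _ _).trans (add_le_add (norm_add_le _ _) le_rfl)

/-- **ROW `|∂^{η*}∂^ηA|`** of (165): the flat second-order letter of `A = A₁ + 𝔄 − R` at `(z, μ)` is bounded by the sum of the three (§1 linearity).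
[cite: Balaban1985Variational, (159) p.303, (165) p.304] -/
theorem norm_d2_le_of_decomp (hA : A = A₁ + 𝔄 - R) (η : ℝ) (μ : Fin P.d) (z : B7Prop1Explicit.Site P.d) :
    ‖pdiv η (1 : B7Prop1Explicit.Site P.d → Fin P.d → (Matrix (Fin N) (Fin N) ℂ)ˣ)
        (plaqCovDeriv η (1 : B7Prop1Explicit.Site P.d → Fin P.d → (Matrix (Fin N) (Fin N) ℂ)ˣ) (pull A 0)) μ z‖ ≤
      ‖pdiv η (1 : B7Prop1Explicit.Site P.d → Fin P.d → (Matrix (Fin N) (Fin N) ℂ)ˣ)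
          (plaqCovDeriv η (1 : B7Prop1Explicit.Site P.d → Fin P.d → (Matrix (Fin N) (Fin N) ℂ)ˣ) (pull A₁ 0)) μ z‖ +
      ‖pdiv η (1 : B7Prop1Explicit.Site P.d → Fin P.d → (Matrix (Fin N) (Fin N) ℂ)ˣ)
          (plaqCovDeriv η (1 : B7Prop1Explicit.Site P.d → Fin P.d → (Matrix (Fin N) (Fin N) ℂ)ˣ) (pull 𝔄 0)) μ z‖ +
      ‖pdiv η (1 : B7Prop1Explicit.Site P.d → Fin P.d → (Matrix (Fin N) (Fin N) ℂ)ˣ)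
          (plaqCovDeriv η (1 : B7Prop1Explicit.Site P.d → Fin P.d → (Matrix (Fin N) (Fin N) ℂ)ˣ) (pull R 0)) μ z‖ := by
  rw [hA, d2_flat_pull_sub, d2_flat_pull_add]
  exact (norm_sub_le _ _).trans (add_le_add (norm_add_le _ _) le_rfl)

end Decomp

/-! ## §3 The socket's three torus hypotheses from per-piece bounds -/

/-- **(159) ⇒ (167) ON THE LAYERS, FOR THE SOCKET**: if on the `SideTouches` layer of a `ℤᵈ` region `S` the three pieces `A₁`, `𝔄`, `R` of
`A = A₁ + 𝔄 − R` have sup sizes `≤ e₁, e₂, e₃`, scaled-gradient sizes `≤ e₁, e₂, e₃` and (on the `BondTouches` layer) flat second-order sizes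
`≤ e₁, e₂, e₃`, and `e₁ + e₂ + e₃ < α₂`, then `A` satisfies the three torus-native hypotheses `h1`/`h2`/`h3` of
`Prop8PullbackDict.localChart_top_of_torus` (resp. `cond140_flat_pull_of_torus` at the top scale) at threshold `α₂`.  Print: `e₂ = ¼M_Δmax{B₃ε₁, ½ε₀}`
((164)), `e₁ = B₀C₄(36dL²B₁Mε₀)²`, `e₃ = B₀4C₂(36dL²B₁Mε₀)²` ((165)), `e₁ + e₃ ≤ ⅛M′ε₀` by (166). [cite: Balaban1985Variational, (159) p.303, (164)–(167) p.304] -/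
theorem torusBounds_of_decomp {A A₁ 𝔄 R : (PBond P 0 → Matrix (Fin N) (Fin N) ℂ)} (hA : A = A₁ + 𝔄 - R) {η α₂ e₁ e₂ e₃ : ℝ}
    (hsum : e₁ + e₂ + e₃ < α₂) (S : Set (B7Prop1Explicit.Site P.d))
    (s₁ : ∀ (z : B7Prop1Explicit.Site P.d) (τ : Fin P.d), SideTouches S z τ → ‖A₁ ⟨transl 0 z, τ⟩‖ ≤ e₁)
    (s₂ : ∀ (z : B7Prop1Explicit.Site P.d) (τ : Fin P.d), SideTouches S z τ → ‖𝔄 ⟨transl 0 z, τ⟩‖ ≤ e₂)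
    (s₃ : ∀ (z : B7Prop1Explicit.Site P.d) (τ : Fin P.d), SideTouches S z τ → ‖R ⟨transl 0 z, τ⟩‖ ≤ e₃)
    (g₁ : ∀ (z : B7Prop1Explicit.Site P.d) (κ τ : Fin P.d), SideTouches S z τ →
      ‖η⁻¹ • (A₁ ⟨(transl 0 z).shift κ, τ⟩ - A₁ ⟨transl 0 z, τ⟩)‖ ≤ e₁)
    (g₂ : ∀ (z : B7Prop1Explicit.Site P.d) (κ τ : Fin P.d), SideTouches S z τ →
      ‖η⁻¹ • (𝔄 ⟨(transl 0 z).shift κ, τ⟩ - 𝔄 ⟨transl 0 z, τ⟩)‖ ≤ e₂)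
    (g₃ : ∀ (z : B7Prop1Explicit.Site P.d) (κ τ : Fin P.d), SideTouches S z τ →
      ‖η⁻¹ • (R ⟨(transl 0 z).shift κ, τ⟩ - R ⟨transl 0 z, τ⟩)‖ ≤ e₃)
    (d₁ : ∀ (z : B7Prop1Explicit.Site P.d) (μ : Fin P.d), BondTouches S z μ →
      ‖pdiv η (1 : B7Prop1Explicit.Site P.d → Fin P.d → (Matrix (Fin N) (Fin N) ℂ)ˣ)
          (plaqCovDeriv η (1 : B7Prop1Explicit.Site P.d → Fin P.d → (Matrix (Fin N) (Fin N) ℂ)ˣ) (pull A₁ 0)) μ z‖ ≤ e₁)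
    (d₂ : ∀ (z : B7Prop1Explicit.Site P.d) (μ : Fin P.d), BondTouches S z μ →
      ‖pdiv η (1 : B7Prop1Explicit.Site P.d → Fin P.d → (Matrix (Fin N) (Fin N) ℂ)ˣ)
          (plaqCovDeriv η (1 : B7Prop1Explicit.Site P.d → Fin P.d → (Matrix (Fin N) (Fin N) ℂ)ˣ) (pull 𝔄 0)) μ z‖ ≤ e₂)
    (d₃ : ∀ (z : B7Prop1Explicit.Site P.d) (μ : Fin P.d), BondTouches S z μ →
      ‖pdiv η (1 : B7Prop1Explicit.Site P.d → Fin P.d → (Matrix (Fin N) (Fin N) ℂ)ˣ)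
          (plaqCovDeriv η (1 : B7Prop1Explicit.Site P.d → Fin P.d → (Matrix (Fin N) (Fin N) ℂ)ˣ) (pull R 0)) μ z‖ ≤ e₃) :
    (∀ (z : B7Prop1Explicit.Site P.d) (τ : Fin P.d), SideTouches S z τ → ‖A ⟨transl 0 z, τ⟩‖ < α₂) ∧
    (∀ (z : B7Prop1Explicit.Site P.d) (κ τ : Fin P.d), SideTouches S z τ →
      ‖η⁻¹ • (A ⟨(transl 0 z).shift κ, τ⟩ - A ⟨transl 0 z, τ⟩)‖ < α₂) ∧
    (∀ (z : B7Prop1Explicit.Site P.d) (μ : Fin P.d), BondTouches S z μ →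
      ‖pdiv η (1 : B7Prop1Explicit.Site P.d → Fin P.d → (Matrix (Fin N) (Fin N) ℂ)ˣ)
          (plaqCovDeriv η (1 : B7Prop1Explicit.Site P.d → Fin P.d → (Matrix (Fin N) (Fin N) ℂ)ˣ) (pull A 0)) μ z‖ < α₂) := by
  refine ⟨fun z τ hz => ?_, fun z κ τ hz => ?_, fun z μ hz => ?_⟩
  · exact ((norm_apply_le_of_decomp hA _).trans (add_le_add_three (s₁ z τ hz) (s₂ z τ hz) (s₃ z τ hz))).trans_lt hsum
  · exact ((norm_grad_le_of_decomp hA η⁻¹ _ _).trans (add_le_add_three (g₁ z κ τ hz) (g₂ z κ τ hz) (g₃ z κ τ hz))).trans_lt hsum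
  · exact ((norm_d2_le_of_decomp hA η μ z).trans (add_le_add_three (d₁ z μ hz) (d₂ z μ hz) (d₃ z μ hz))).trans_lt hsum

end Summit.QuantumFields.YangMills.Theorems.Prop8PullbackLin

end
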